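import Summits.CriticalPhenomena.PercolationContinuityZ3.Theorems.PercNearOneGluingNoHeavyQuantSpineSDEC
import HarnessLib

/-!
# QUANT lane R8, T-DEC: EVERY LAW WITH A HEAVY TOP ATOM IS GATE-STABLE DEC — `x ≤ μ M ⟹ SDEC x M μ` (a one-inequality
# sufficient condition for admissibility at every gate and every layer; the law-level form of "caterpillar laws are SDEC")

builds on p205010 (kernel theorem, internal audit signed; external expert review pending)

Support file (`--supports stmt-CriticalPhenomena-4575`), QUANT lane typer seat prim-quant-stmt (gen 35), rung R8 of
`run/shared/lean/prim/quant/LADDER.md`; memo `run/shared/lean/prim/quant/prim-quant-stmt-g35/GATESTABLE-G35.md`.  Theorems only, standard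
axioms, no sorries, no new definitions.  Uses Conjecture R as a theorem (`LawDec.gatedShift_sdecUpTo`, typer g26,
`…QuantGatedShiftDECHolds`), `sdec_gate`, `sdec_point`/`sdec_gate_point`, `shift_laws`, `decAt_of_sdec`, `tail_ge_of_decAt`.

THE OBSERVATION.  Every probability law `μ` on `{0..M}` is the reached-relay count of a CATERPILLAR (spine): peel the atom at `0` as a
gate `q = 1 − μ 0`, shift the rest down by one sure relay, and recurse — `μ = gate_q (μ′(· − 1))` with `μ′ s = μ (s+1) / q`.  Along this
chain the cumulative gate of the last block is exactly the TOP MASS `μ M`, so the caterpillar has all its relay marginals `≥ x` as soon as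
`x ≤ μ M`.  Typer g26's `spineBuilt_sdec` (spines are SDEC, from Conjecture R) therefore has a LAW-LEVEL form with a single hypothesis:

* **`LawDec.sdec_of_top_ge`** — for `0 < x < 1` and a probability law `μ` on `{0..M}` (nonnegative, vanishing above `M`, mass `1`) with
  `x ≤ μ M`: `μ` is top-affordable (`x·M ≤ mean μ`) and `SDEC x M μ` — for EVERY gate `0 < q ≤ 1` and EVERY layer `j′ < M` the gated law
  `gate μ q` is DEC(j′) at floor `q·x`.  Direct induction on `M` (no `SpineBuilt` bookkeeping): the inner law `μ′` has top mass
  `μ M / q ≥ x / q`; if `x/q < 1` the induction hypothesis + `gatedShift_sdecUpTo` (one sure relay) + `sdec_gate` apply, and if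
  `x/q ≥ 1` the law is the block `{0: 1−q, M: q}` (`sdec_gate_point` / `sdec_point`).
* `LawDec.decAt_of_top_ge` — hence DEC(j′) at every layer `j′` at floor `x` (`decAt_of_sdec`), and `LawDec.tail_ge_of_top_ge` — the FAR
  row at every dominant layer (trivial here, recorded for the interface).

WHY IT IS RECORDED (typer g35, STATEMENTS §AO).  (1) It generalises arm-2 g35's `…QuantAD3HeavyTop` ("a heavy top atom carries every
layer", three-atom laws, one gate) to all laws, all gates, all layers.  (2) It explains the shape of EVERY finite-depth closure witness on
record (K-37a, K-37c, K-68a, and typer g35's gate-stable K-35a witnesses {1,2,5,19}, {2,3,5,20}, …): a law violating any consequence of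
gate-stable DEC must have top mass `< x`; the adversaries' maximisers are exactly "near-caterpillars whose last block is lighter than the
floor".  (3) It gives the census seats an explicit positive-measure family of admissible laws of arbitrary support for planted controls.
HONEST STATUS: nothing here bears on the open nodes — `SDECConvClosed`, `GatedConvEmptyFree`, `SingleGateConvClosed`, `FarTreeRow`
remain OPEN; laws with a light top atom are where the light half lives.  RATE class log* / honest sentence unchanged.

[this work]; Conjecture R: typer g25/g26; spines: typer g26; SDEC: prim-quant-census-2 g53 (this lane).  Nothing here is cited as a
published result.  The gluing rows served [cite: KozmaNitzan2024, Conjecture 3 (p. 15)]; product measure [cite: Grimmett1999, §1.3 p. 10].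
-/

noncomputable section

namespace Summit.CriticalPhenomena.PercolationContinuityZ3.Theorems

namespace Quant

open Finset

namespace LawDec

/-! ### Peeling the zero atom: `μ = gate_q (μ′(· − 1))`, `q = 1 − μ 0`, `μ′ s = μ (s+1) / q` -/

/-- law facts of the peeled law `μ′ s = μ (s+1) / q` (`q = 1 − μ 0 > 0`): nonnegative, vanishing above `M`, mass `1`, and
`gate (μ′(· − 1)) q = μ`. [this work] -/
theorem peel_laws (M : ℕ) (μ : ℕ → ℝ) (hμ0 : ∀ h, 0 ≤ μ h) (hμM : ∀ h, M + 1 < h → μ h = 0)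
    (hμ1 : ∑ h ∈ Finset.range (M + 1 + 1), μ h = 1) (hq : 0 < 1 - μ 0) :
    (∀ s, 0 ≤ (fun s => μ (s + 1) / (1 - μ 0)) s) ∧
      (∀ s, M < s → (fun s => μ (s + 1) / (1 - μ 0)) s = 0) ∧
      (∑ s ∈ Finset.range (M + 1), (fun s => μ (s + 1) / (1 - μ 0)) s = 1) ∧
      gate (fun t => if 1 ≤ t then (fun s => μ (s + 1) / (1 - μ 0)) (t - 1) else 0) (1 - μ 0) = μ := by
  refine ⟨fun s => div_nonneg (hμ0 _) hq.le, fun s hs => ?_, ?_, ?_⟩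
  · beta_reduce
    rw [hμM (s + 1) (by omega), zero_div]
  · beta_reduce
    rw [← Finset.sum_div, div_eq_one_iff_eq (ne_of_gt hq)]
    have h := hμ1
    rw [Finset.sum_range_succ'] at h
    linarith
  · funext t
    simp only [gate]
    by_cases ht : 1 ≤ t
    · rw [if_pos ht, if_neg (by omega), show t - 1 + 1 = t by omega, add_zero]
      field_simp
    · have ht0 : t = 0 := by omega
      subst ht0
      simp

/-- mean of the peeled law: `(1 − μ 0) · (mean μ′ + 1) = mean μ`. [this work] -/
theorem peel_mean (M : ℕ) (μ : ℕ → ℝ) (hμ1 : ∑ h ∈ Finset.range (M + 1 + 1), μ h = 1) (hq : 0 < 1 - μ 0) :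
    (1 - μ 0) * ((∑ s ∈ Finset.range (M + 1), (s : ℝ) * (fun s => μ (s + 1) / (1 - μ 0)) s) + 1)
      = ∑ h ∈ Finset.range (M + 1 + 1), (h : ℝ) * μ h := by
  have hmass : ∑ s ∈ Finset.range (M + 1), μ (s + 1) = 1 - μ 0 := by
    have h := hμ1
    rw [Finset.sum_range_succ'] at h
    linarith
  have e1 : (1 - μ 0) * ∑ s ∈ Finset.range (M + 1), (s : ℝ) * (fun s => μ (s + 1) / (1 - μ 0)) s
      = ∑ s ∈ Finset.range (M + 1), (s : ℝ) * μ (s + 1) := by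
    rw [Finset.mul_sum]
    refine Finset.sum_congr rfl fun s _ => ?_
    beta_reduce
    field_simp
  rw [mul_add, e1, mul_one, Finset.sum_range_succ' (fun h => (h : ℝ) * μ h)]
  push_cast
  rw [zero_mul, add_zero, ← hmass, ← Finset.sum_add_distrib]
  refine Finset.sum_congr rfl fun s _ => by ring

/-! ### Heavy top ⟹ SDEC -/

/-- **EVERY LAW WITH A HEAVY TOP ATOM IS TOP-AFFORDABLE AND GATE-STABLE DEC.**  For `0 < x < 1` and a probability law `μ` on `{0..M}`
(nonnegative, vanishing above `M`, mass `1`) whose top atom carries mass `μ M ≥ x`: `x·M ≤ mean μ` and `SDEC x M μ` (every gate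
`0 < q ≤ 1`, every layer `j′ < M`: `gate μ q` is DEC(j′) at floor `q·x`).  The law is the count law of a caterpillar whose last block has
marginal `μ M`; induction on `M` peeling the zero atom (`gatedShift_sdecUpTo` = Conjecture R for the sure relay, `sdec_gate` for the gate,
the block `sdec_gate_point` / `sdec_point` at the bottom). [this work] -/
theorem sdec_of_top_ge : ∀ (M : ℕ) (x : ℝ) (μ : ℕ → ℝ), 0 < x → x < 1 →
    (∀ h, 0 ≤ μ h) → (∀ h, M < h → μ h = 0) → (∑ h ∈ Finset.range (M + 1), μ h = 1) → x ≤ μ M →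
    x * (M : ℝ) ≤ (∑ h ∈ Finset.range (M + 1), (h : ℝ) * μ h) ∧ SDEC x M μ := by
  intro M
  induction M with
  | zero =>
    intro x μ hx0 _ hμ0 _ _ _
    refine ⟨?_, fun q _ _ j' hj => absurd hj (Nat.not_lt_zero _)⟩
    rw [Nat.cast_zero, mul_zero, zero_add, Finset.sum_range_one, Nat.cast_zero, zero_mul]
  | succ M ih =>
    intro x μ hx0 hx1 hμ0 hμM hμ1 htop
    -- the gate `q = 1 − μ 0` dominates the top mass, hence the floor
    have hqtop : μ (M + 1) ≤ 1 - μ 0 := by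
      have h := hμ1
      rw [Finset.sum_range_succ', Finset.sum_range_succ] at h
      have hrest : 0 ≤ ∑ s ∈ Finset.range M, μ (s + 1) := Finset.sum_nonneg fun s _ => hμ0 _
      linarith
    have hq0 : 0 < 1 - μ 0 := lt_of_lt_of_le (lt_of_lt_of_le hx0 htop) hqtop
    have hq1 : 1 - μ 0 ≤ 1 := by linarith [hμ0 0]
    obtain ⟨n0, zM, s1, hgate⟩ := peel_laws M μ hμ0 hμM hμ1 hq0
    have hmean := peel_mean M μ hμ1 hq0
    set q : ℝ := 1 - μ 0 with hqdef
    set μ' : ℕ → ℝ := fun s => μ (s + 1) / q with hμ'def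
    have hμ'le : μ' M ≤ 1 := by
      have h := s1
      rw [Finset.sum_range_succ] at h
      have : 0 ≤ ∑ s ∈ Finset.range M, μ' s := Finset.sum_nonneg fun s _ => n0 s
      linarith
    -- the TOP-AFFORDABILITY conclusion: mean μ = q (mean μ′ + 1) ≥ q (x′ M + 1) ≥ x (M + 1) in both cases below, from mean μ′ ≥ (μ′ M)·M
    have hmean' : μ' M * (M : ℝ) ≤ ∑ s ∈ Finset.range (M + 1), (s : ℝ) * μ' s := by
      rw [Finset.sum_range_succ]
      have : 0 ≤ ∑ s ∈ Finset.range M, (s : ℝ) * μ' s :=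
        Finset.sum_nonneg fun s _ => mul_nonneg (Nat.cast_nonneg s) (n0 s)
      nlinarith [n0 M]
    have htop' : x ≤ q * μ' M := by
      have e : q * μ' M = μ (M + 1) := by
        simp only [hμ'def]
        field_simp
      rw [e]; exact htop
    have hta : x * ((M + 1 : ℕ) : ℝ) ≤ ∑ h ∈ Finset.range (M + 1 + 1), (h : ℝ) * μ h := by
      rw [← hmean]
      push_cast
      have h1 : q * (μ' M * (M : ℝ)) ≤ q * ∑ s ∈ Finset.range (M + 1), (s : ℝ) * μ' s :=
        mul_le_mul_of_nonneg_left hmean' hq0.le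
      have h2 : x * (M : ℝ) ≤ q * (μ' M * (M : ℝ)) := by
        rw [← mul_assoc]; exact mul_le_mul_of_nonneg_right htop' (Nat.cast_nonneg M)
      have h3 : x ≤ q := htop.trans hqtop
      nlinarith
    refine ⟨hta, ?_⟩
    -- SDEC: two cases on whether the inner floor x/q is < 1
    by_cases hcase : x < q * μ' M ∨ μ' M < 1
    · -- general case: the inner law has top mass ≥ x/q and x/q < 1
      have hxq : x < q := by
        rcases hcase with h | h
        · have : q * μ' M ≤ q * 1 := mul_le_mul_of_nonneg_left hμ'le hq0.le
          linarith
        · have : q * μ' M < q * 1 := mul_lt_mul_of_pos_left h hq0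
          linarith [htop']
      have hx'1 : x / q < 1 := by rwa [div_lt_one hq0]
      have hx'0 : 0 < x / q := div_pos hx0 hq0
      have hx'top : x / q ≤ μ' M := by
        rw [div_le_iff₀ hq0, mul_comm]; exact htop'
      obtain ⟨ta', sd'⟩ := ih (x / q) μ' hx'0 hx'1 n0 zM s1 hx'top
      -- one sure relay (Conjecture R), then the gate q
      have shS : SDEC (x / q) (M + 1) (fun t => if 1 ≤ t then μ' (t - 1) else 0) := by
        have := gatedShift_sdecUpTo (x / q) 1 1 M μ' hx'0 hx'1.le le_rfl (by linarith) le_rfl n0 zM s1 ta'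
          ((sdecUpTo_one_iff (x / q) M μ').2 sd')
        rw [show 1 + M = M + 1 by omega] at this
        exact (sdecUpTo_one_iff (x / q) (M + 1) _).1 this
      have hS := sdec_gate shS q hq0 hq1
      have e : q * (x / q) = x := by field_simp
      rw [e, hgate] at hS
      exact hS
    · -- degenerate case: μ′ = δ_M, i.e. μ is the block {0: 1−q, M+1: q}
      have hμ'M : 1 ≤ μ' M := le_of_not_gt fun h => hcase (Or.inr h)
      have hμ'M1 : μ' M = 1 := le_antisymm hμ'le hμ'M
      have hμ'eq : μ' = fun h => if h = M then (1 : ℝ) else 0 := by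
        funext h
        by_cases hh : h = M
        · rw [if_pos hh, hh, hμ'M1]
        · rw [if_neg hh]
          rcases lt_or_gt_of_ne hh with hlt | hgt
          · -- below the top: the remaining mass is zero
            have hsum : ∑ s ∈ Finset.range M, μ' s = 0 := by
              have e := Finset.sum_range_succ μ' M
              rw [s1, hμ'M1] at e
              linarith
            exact (Finset.sum_eq_zero_iff_of_nonneg (fun s _ => n0 s)).1 hsum h (Finset.mem_range.2 hlt)
          · exact zM h hgt
      have hshift : (fun t => if 1 ≤ t then μ' (t - 1) else 0) = fun h => if h = M + 1 then (1 : ℝ) else 0 := by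
        funext t
        rw [hμ'eq]
        by_cases ht : 1 ≤ t
        · simp only [if_pos ht]
          by_cases htM : t = M + 1
          · rw [if_pos (by omega), if_pos htM]
          · rw [if_neg (by omega), if_neg htM]
        · rw [if_neg ht, if_neg (by omega)]
      rw [← hgate, hshift]
      -- the block: SDEC at floor q (sdec_gate_point), lowered to x ≤ q; or q = 1 and sdec_point
      rcases lt_or_eq_of_le hq1 with hqlt | hqeq
      · have hxq' : x ≤ q := htop.trans hqtop
        have hb := sdec_gate_point q hq0 hq1 (M + 1)
        exact sdec_mono hb hxq' hqlt
      · rw [hqeq, gate_one]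
        exact sdec_point x hx0 hx1.le (M + 1)

/-- **every law with a heavy top atom is DEC(j′) at EVERY layer** at floor `x` (`0 < x < 1`, `x ≤ μ M`). [this work] -/
theorem decAt_of_top_ge (M : ℕ) (x : ℝ) (μ : ℕ → ℝ) (hx0 : 0 < x) (hx1 : x < 1)
    (hμ0 : ∀ h, 0 ≤ μ h) (hμM : ∀ h, M < h → μ h = 0) (hμ1 : ∑ h ∈ Finset.range (M + 1), μ h = 1)
    (htop : x ≤ μ M) (j' : ℕ) : DECAt x j' M μ := by
  obtain ⟨ta, sd⟩ := sdec_of_top_ge M x μ hx0 hx1 hμ0 hμM hμ1 htop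
  exact decAt_of_sdec sd hx0 hx1 hμ0 hμM hμ1 ta j'

/-- **the gated versions too**: for every gate `0 < q ≤ 1`, `gate μ q` is DEC(j′) at floor `q·x` at every layer `j′ < M`
(the literal content of `SDEC`, spelled out for users). [this work] -/
theorem decAt_gate_of_top_ge (M : ℕ) (x q : ℝ) (μ : ℕ → ℝ) (hx0 : 0 < x) (hx1 : x < 1) (hq0 : 0 < q) (hq1 : q ≤ 1)
    (hμ0 : ∀ h, 0 ≤ μ h) (hμM : ∀ h, M < h → μ h = 0) (hμ1 : ∑ h ∈ Finset.range (M + 1), μ h = 1)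
    (htop : x ≤ μ M) (j' : ℕ) (hj : j' < M) : DECAt (q * x) j' M (gate μ q) :=
  (sdec_of_top_ge M x μ hx0 hx1 hμ0 hμM hμ1 htop).2 q hq0 hq1 j' hj

/-- **the FAR row for heavy-top laws** (trivial directly — `P(N ≥ j′+1) ≥ μ M ≥ x` — but here as the `tail_ge_of_decAt` instance, for the
interface): at every dominant layer `2j′ < mean`, `x ≤ Σ_{h > j′} μ h`. [this work] -/
theorem tail_ge_of_top_ge (M : ℕ) (x : ℝ) (μ : ℕ → ℝ) (hx0 : 0 < x) (hx1 : x < 1)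
    (hμ0 : ∀ h, 0 ≤ μ h) (hμM : ∀ h, M < h → μ h = 0) (hμ1 : ∑ h ∈ Finset.range (M + 1), μ h = 1)
    (htop : x ≤ μ M) (j' : ℕ) (hdom : (2 * j' : ℝ) < ∑ h ∈ Finset.range (M + 1), (h : ℝ) * μ h) :
    x ≤ ∑ h ∈ Finset.Ico (j' + 1) (M + 1), μ h :=
  tail_ge_of_decAt x j' M μ hx1.le (decAt_of_top_ge M x μ hx0 hx1 hμ0 hμM hμ1 htop j') hdom

end LawDec

end Quant

end Summit.CriticalPhenomena.PercolationContinuityZ3.Theorems
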